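import Literature.MathematicalPhysics.QuantumFieldTheory.Balaban1983to89.B4Eq19LatticePoincareMorrey
import HarnessLib

/-!
# Route `UnitScaleTilt`, crux K1 «MinimiserStabilityRegPr» (stmt-QuantumFields-19200), EX row (5) `norm_G`, STOREY H, programme «H2-LOC» (chair WORD №60 (2)–(3)), brick (C3c) — **MORREY'S
# TWO-CENTRE CONCLUSION FOR VECTOR-VALUED LATTICE FUNCTIONS**: lit ✓`B4Eq19LatticePoincareMorrey.abs_sub_le_of_morrey` (real-valued `u` on `ℤ^d`) transferred to `u : ℤ^d → E`, `E` ANY real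
# normed space (the gauge parameters' `W₂`, read as a real space): if `Σ_{Q_ρ(z)} Σ_μ ‖u(y+e_μ) − u(y)‖² ≤ N(ρ+1)^{d−1}` for `0 ≤ ρ ≤ R₀` at both centres `z ∈ {a, x′}`, `x′ ∈ Q_{ρ₀}(a)`, `1 ≤ ρ₀`,
# `2ρ₀ ≤ R₀`, then `‖u(x′) − u(a)‖ ≤ 17·√(16 d 8^d)·√(N(2ρ₀+1))` — by a norming functional `g` (Hahn–Banach, ✓`exists_dual_vector''`) and the scalar lemma for `g ∘ u`.

Cell `ym3-torus` (HUMAN RULING D-0037; rung R3 = SU(2) YM₃ on T³ — NOT d = 4, NOT infinite volume, NOT a mass gap, NOT Clay).  Width seat `ym3-torus-px21` (gen 16); chair WORD №60 (3)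
pen C3 (px19 g16 LOCATE-H2-FILE2 §3: «Morrey on `re⟪e,·⟫`-components of `u`» — done here once for all components by duality).  THEOREMS ONLY (0 `def`, 0 `sorry`, default heartbeats);
`--supports stmt-QuantumFields-19200 --as helper`; count-neutral.

WHAT IS PROVED (ns `Summit.QuantumFields.YangMills.Theorems.Prop7MorreyNormed`).
* `gradSq_dual_comp_le` — for `g ∈ E*` with `‖g‖ ≤ 1`: `gradSq (g ∘ u) Q ≤ Σ_{y∈Q} Σ_μ ‖u(y+e_μ) − u(y)‖²`.
* ★★★ `norm_sub_le_of_morrey` — THE VECTOR-VALUED MORREY CONCLUSION (statement above).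
USE (C4, px19 g16): with `u` the gauge parameter in the axial gauge of (i) and `‖u(y+e_μ) − u(y)‖² ≤ 2η²‖(D_V u)(y,μ)‖² + 2δ²‖u(y)‖²` (plain vs covariant difference, `‖Ad(V_b) − 1‖ ≤ δ`), the
hypothesis is fed by ✓`Prop7CampanatoMorreyDecayEps.morrey_decay_eps_pow` (C3b) ∘ {C1, C2}.
HONEST SCOPE.  A duality transfer, proved; C1∕C2∕C4∕C5, `hHlocV`, `hWsup`, FILE 2, norm_G, EX, 19200 and rung R3 are NOT proved here; the Yang–Mills mass gap is NOT proved.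

References: M. Giaquinta, Annals of Math. Studies **105** (1983) [Giaquinta1984] (Ch. III §1 Thm 1.2 pp. 70–72); T. Bałaban, CMP **96** (1984) 223–250 [Balaban1984PropagatorsII] ((1.9) p. 226).
-/

set_option autoImplicit false

noncomputable section

open scoped BigOperators

namespace Summit.QuantumFields.YangMills.Theorems.Prop7MorreyNormed

open Literature.MathematicalPhysics.QuantumFieldTheory.Balaban1983to89.B4Eq19LatticeOperators (Zd unitVec box gradSq fdiff fdiff_apply)
open Literature.MathematicalPhysics.QuantumFieldTheory.Balaban1983to89.B4Eq19LatticePoincareMorrey (abs_sub_le_of_morrey)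

variable {E : Type*} [NormedAddCommGroup E] [NormedSpace ℝ E] {d : ℕ}

/-- the gradient energy of a component `g ∘ u`, `‖g‖ ≤ 1`, is dominated by the vector energy `Σ_{y∈Q} Σ_μ ‖u(y+e_μ) − u(y)‖²`. [cite: Giaquinta1984, Ch. III §1 Thm 1.2 p.70] -/
theorem gradSq_dual_comp_le (g : StrongDual ℝ E) (hg : ‖g‖ ≤ 1) (u : Zd d → E) (Q : Finset (Zd d)) :
    gradSq (fun y => g (u y)) Q ≤ ∑ y ∈ Q, ∑ μ, ‖u (y + unitVec μ) - u y‖ ^ 2 := by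
  unfold gradSq
  refine Finset.sum_le_sum fun y _ => Finset.sum_le_sum fun μ _ => ?_
  rw [fdiff_apply, ← map_sub]
  have h1 : |g (u (y + unitVec μ) - u y)| ≤ ‖u (y + unitVec μ) - u y‖ := by
    rw [← Real.norm_eq_abs]
    exact (g.le_opNorm _).trans (by nlinarith [norm_nonneg (u (y + unitVec μ) - u y)])
  have h2 : 0 ≤ |g (u (y + unitVec μ) - u y)| := abs_nonneg _
  rw [← sq_abs]
  exact pow_le_pow_left₀ h2 h1 2

/-- ★★★ **MORREY'S TWO-CENTRE CONCLUSION, VECTOR-VALUED.**  If `x′ ∈ Q_{ρ₀}(a)`, `1 ≤ ρ₀`, `2ρ₀ ≤ R₀`, and `Σ_{y∈Q_ρ(z)} Σ_μ ‖u(y+e_μ) − u(y)‖² ≤ N(ρ+1)^{d−1}` for all `0 ≤ ρ ≤ R₀`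
at both centres `z ∈ {a, x′}`, then `‖u(x′) − u(a)‖ ≤ 17·√(16 d 8^d)·√(N(2ρ₀+1))` — lit ✓`abs_sub_le_of_morrey` for the component `g ∘ u`, `g` a norming functional of `u(x′) − u(a)`
(✓`exists_dual_vector''`). [cite: Giaquinta1984, Ch. III §1 Thm 1.2 pp.70–72; Balaban1984PropagatorsII, (1.9) p.226] -/
theorem norm_sub_le_of_morrey (hd : 1 ≤ d) (u : Zd d → E) {a x' : Zd d} {ρ₀ : ℕ} (hρ₀ : 1 ≤ ρ₀) (hx' : x' ∈ box a (ρ₀ : ℤ)) {N : ℝ} (hN : 0 ≤ N)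
    {R₀ : ℤ} (hR₀ : 2 * (ρ₀ : ℤ) ≤ R₀)
    (hgrad_a : ∀ ρ : ℤ, 0 ≤ ρ → ρ ≤ R₀ → ∑ y ∈ box a ρ, ∑ μ, ‖u (y + unitVec μ) - u y‖ ^ 2 ≤ N * ((ρ : ℝ) + 1) ^ (d - 1))
    (hgrad_x : ∀ ρ : ℤ, 0 ≤ ρ → ρ ≤ R₀ → ∑ y ∈ box x' ρ, ∑ μ, ‖u (y + unitVec μ) - u y‖ ^ 2 ≤ N * ((ρ : ℝ) + 1) ^ (d - 1)) :
    ‖u x' - u a‖ ≤ 17 * Real.sqrt (16 * d * 8 ^ d) * Real.sqrt (N * (2 * (ρ₀ : ℝ) + 1)) := by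
  obtain ⟨g, hg1, hgx⟩ := exists_dual_vector'' ℝ (u x' - u a)
  have h := abs_sub_le_of_morrey hd (fun y => g (u y)) hρ₀ hx' hN hR₀
    (fun ρ hρ hρR => (gradSq_dual_comp_le g hg1 u _).trans (hgrad_a ρ hρ hρR))
    (fun ρ hρ hρR => (gradSq_dual_comp_le g hg1 u _).trans (hgrad_x ρ hρ hρR))
  have e : g (u x') - g (u a) = ‖u x' - u a‖ := by rw [← map_sub, hgx]; rfl
  rw [e, abs_of_nonneg (norm_nonneg _)] at h
  exact h

end Summit.QuantumFields.YangMills.Theorems.Prop7MorreyNormed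

end
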